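import Mathlib
import Literature.Computability.AlgebraicComplexity.GenericTorusGrading
import Literature.Computability.AlgebraicComplexity.LandsbergRessayreNormalForm
import Literature.Computability.AlgebraicComplexity.LRLiftCharacter

/-!
# Crux `RankRigidMinimalRepr` (stmt-ValiantsHypothesis-18034), line `PairTiedTorusBound`, stub `stub_levelDecomp` —
# step 2: the SPECTRAL GAUGE of an exact lift (generalised-eigenspace adapted bases containing the kernel line)

Route `ValiantsHypothesis/RigidityForcesSymmetry`, crux `RankRigidMinimalRepr`, registered line
`Cruxes/RankRigidMinimalRepr/Lines/PairTiedTorusBound.lean`, dictionary stub `stub_levelDecomp` (helper 2).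
Convention of the tree's LR17 files: `n` = size of the matrix.

**Statement (`exists_spectral_gauge`).**  Let `Λ, A_i` (`i ∈ ι`) be `n × n` complex matrices, `rank Λ = n - 1`, and
`(P, Q)` an EXACT LIFT of a torus element: `P Λ = Λ Q` and `P A_i = c_i · A_i Q` for scalars `c_i`.  Then there
are invertible constant matrices `g, h`, weight functions `θ, ρ : [n] → ℂ` and an index `i₀` such that

* `g Λ h = Λ_{i₀}` (the Landsberg–Ressayre normal form: `1` on the diagonal except `0` at `(i₀, i₀)`);
* `(g A_i h)_{rs} ≠ 0 ⇒ ρ r = c_i · θ s` (the coefficient matrices are WEIGHT-GRADED);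
* `ρ r = θ r` for `r ≠ i₀`; `ker Λ ⊆` the generalised `θ i₀`-eigenspace of `Q` (the kernel weight `γ₀ = θ i₀`);
  and the generalised `ρ i₀`-eigenspace of `P` is NOT contained in `range Λ` (the top weight `β = ρ i₀`).

**Proof.**  Decompose `ℂⁿ` into the generalised eigenspaces of `Q` (they span, `ℂ` being algebraically closed:
`Module.End.iSup_maxGenEigenspace_eq_top`, and are independent) and collect a basis `b₀` of generalised
eigenvectors; the kernel vector `v₀` of `Λ` (a `Q`-eigenvector, `Λ Q v₀ = P Λ v₀ = 0`) has a non-zero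
coordinate `i₀`, necessarily of weight `γ₀`, and exchanging `b₀ i₀` for `v₀` gives a basis `b` of generalised
eigenvectors with `b i₀ = v₀`.  On the target side the vectors `Λ b_i` (`i ≠ i₀`) are independent generalised
eigenvectors of `P` of the same weights (`P Λ = Λ Q`), spanning `range Λ`; complete them by a generalised
eigenvector `w` of `P` outside `range Λ` (one exists since the generalised eigenspaces of `P` span).  In the bases
`(b, w ∪ Λ b)` the matrix of `Λ` is `Λ_{i₀}`, and `A_i` maps the `θ s`-piece of `Q` into the `c_i θ s`-piece of `P`
(`map_maxGenEigenspace_le_of_comp_eq_smul`), so its coordinates along basis vectors of other weights vanish.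

Elementary linear algebra (no Levi–Malcev / central torus as in LR17 §3.5–§6); the equivariance is used for ONE
element and then forgotten.  HONEST FRAMING: helper toward ONE registered stub of a forward rung inside one route;
nothing here bears on the crux `RankRigidMinimalRepr` itself or on `VP ≠ VNP`.
-/

set_option autoImplicit false

-- the mandated summit-side namespace repeats a component by design (single-problem summit)
set_option linter.dupNamespace false

noncomputable section

open Matrix Module Module.End
open Literature.Computability.AlgebraicComplexity

namespace Summit.ValiantsHypothesis.ValiantsHypothesis.Theorems.RigidityForcesSymmetryRankRigidMinimalRepr

namespace SpectralGauge

/-! ### Coordinates of generalised eigenvectors in a basis of generalised eigenvectors -/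

/-- **Weight support of generalised eigenvectors** (re-proved here from `…RigidMinimalReprStubEigenbasis`, to keep this
file's import cone inside `Literature`): if `b` is a basis with `b i` in the generalised eigenspace of `B` for `wt i`,
then every `x` in the generalised eigenspace of `B` for `μ` has `b.repr x i = 0` whenever `wt i ≠ μ`. -/
theorem repr_eq_zero_of_mem_maxGenEigenspace {V : Type*} [AddCommGroup V] [Module ℂ V]
    (B : Module.End ℂ V) {κ : Type*} [Fintype κ] (wt : κ → ℂ) (b : Basis κ ℂ V)
    (hbv : ∀ i, b i ∈ B.maxGenEigenspace (wt i)) (μ : ℂ) (x : V) (hx : x ∈ B.maxGenEigenspace μ)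
    (i : κ) (hi : wt i ≠ μ) : b.repr x i = 0 := by
  classical
  set g : κ → ℂ := fun j => if wt j = μ then 0 else b.repr x j with hg
  have hsum : ∑ j, g j • b j = x - ∑ j, (if wt j = μ then b.repr x j else 0) • b j := by
    rw [eq_sub_iff_add_eq, ← Finset.sum_add_distrib]
    conv_rhs => rw [← b.sum_repr x]
    refine Finset.sum_congr rfl fun j _ => ?_
    rw [← add_smul]
    congr 1
    simp only [hg]
    split_ifs <;> simp
  have h1 : ∑ j, g j • b j ∈ B.maxGenEigenspace μ := by
    rw [hsum]
    refine Submodule.sub_mem _ hx (Submodule.sum_mem _ fun j _ => ?_)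
    split_ifs with h
    · rw [← h]
      exact Submodule.smul_mem _ _ (hbv j)
    · rw [zero_smul]
      exact Submodule.zero_mem _
  have h2 : ∑ j, g j • b j ∈ ⨆ (μ' : ℂ) (_ : μ' ≠ μ), B.maxGenEigenspace μ' := by
    refine Submodule.sum_mem _ fun j _ => ?_
    simp only [hg]
    split_ifs with h
    · rw [zero_smul]
      exact Submodule.zero_mem _
    · exact Submodule.smul_mem _ _
        (Submodule.mem_iSup_of_mem (wt j) (Submodule.mem_iSup_of_mem h (hbv j)))
  have h0 : ∑ j, g j • b j = 0 :=
    Submodule.disjoint_def.mp (B.independent_maxGenEigenspace μ) _ h1 h2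
  have := Fintype.linearIndependent_iff.mp b.linearIndependent g h0 i
  simpa [hg, hi] using this

/-! ### A basis of generalised eigenvectors containing a given generalised eigenvector -/

/-- Over `ℂ`, a finite-dimensional space has a basis of generalised eigenvectors of any endomorphism `B`
(`Module.End.iSup_maxGenEigenspace_eq_top` + independence + `DirectSum.IsInternal.collectedBasis`),
indexed by `Fin (finrank V)`. -/
theorem exists_basis_maxGenEigenspace {V : Type*} [AddCommGroup V] [Module ℂ V] [FiniteDimensional ℂ V]
    (B : Module.End ℂ V) :
    ∃ (b : Basis (Fin (finrank ℂ V)) ℂ V) (wt : Fin (finrank ℂ V) → ℂ),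
      ∀ i, b i ∈ B.maxGenEigenspace (wt i) := by
  classical
  have hint : DirectSum.IsInternal (fun μ : ℂ => B.maxGenEigenspace μ) :=
    (DirectSum.isInternal_submodule_iff_iSupIndep_and_iSup_eq_top _).2
      ⟨B.independent_maxGenEigenspace, B.iSup_maxGenEigenspace_eq_top⟩
  let v : ∀ μ : ℂ, Basis (Fin (finrank ℂ (B.maxGenEigenspace μ))) ℂ (B.maxGenEigenspace μ) :=
    fun μ => Module.finBasis ℂ _
  let b₀ := hint.collectedBasis v
  haveI : Finite (Σ μ : ℂ, Fin (finrank ℂ (B.maxGenEigenspace μ))) := Module.Finite.finite_basis b₀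
  letI : Fintype (Σ μ : ℂ, Fin (finrank ℂ (B.maxGenEigenspace μ))) := Fintype.ofFinite _
  have hcard : Fintype.card (Σ μ : ℂ, Fin (finrank ℂ (B.maxGenEigenspace μ))) = finrank ℂ V :=
    (Module.finrank_eq_card_basis b₀).symm
  let e : (Σ μ : ℂ, Fin (finrank ℂ (B.maxGenEigenspace μ))) ≃ Fin (finrank ℂ V) :=
    Fintype.equivFinOfCardEq hcard
  refine ⟨b₀.reindex e, fun i => (e.symm i).1, fun i => ?_⟩
  rw [Basis.reindex_apply]
  exact hint.collectedBasis_mem v (e.symm i)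

/-- **Exchange.**  If `b` is a basis of generalised eigenvectors of `B` (weights `wt`) and `v₀ ≠ 0` lies in the
generalised `γ₀`-eigenspace, then some basis `b'` of generalised eigenvectors with the SAME weights has `b' i₀ = v₀`
for an index `i₀` of weight `wt i₀ = γ₀` (exchange `b i₀ ↦ v₀` at a non-zero coordinate of `v₀`). -/
theorem exists_basis_maxGenEigenspace_with {n : ℕ}
    (B : Module.End ℂ (Fin n → ℂ)) (v₀ : Fin n → ℂ) (hv₀ : v₀ ≠ 0) (γ₀ : ℂ)
    (hv₀γ : v₀ ∈ B.maxGenEigenspace γ₀) :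
    ∃ (b : Basis (Fin n) ℂ (Fin n → ℂ)) (wt : Fin n → ℂ) (i₀ : Fin n),
      b i₀ = v₀ ∧ wt i₀ = γ₀ ∧ ∀ i, b i ∈ B.maxGenEigenspace (wt i) := by
  classical
  obtain ⟨b₁, wt₁, hb₁⟩ := exists_basis_maxGenEigenspace B
  -- transport to the index type `Fin n`
  have hn : finrank ℂ (Fin n → ℂ) = n := Module.finrank_fin_fun ℂ
  let e : Fin (finrank ℂ (Fin n → ℂ)) ≃ Fin n := finCongr hn
  let b : Basis (Fin n) ℂ (Fin n → ℂ) := b₁.reindex e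
  let wt : Fin n → ℂ := fun i => wt₁ (e.symm i)
  have hb : ∀ i, b i ∈ B.maxGenEigenspace (wt i) := fun i => by
    show b₁.reindex e i ∈ _
    rw [Basis.reindex_apply]; exact hb₁ _
  -- a non-zero coordinate of `v₀`, necessarily of weight `γ₀`
  obtain ⟨i₀, hi₀⟩ : ∃ i₀, b.repr v₀ i₀ ≠ 0 := by
    by_contra! h
    exact hv₀ (b.repr.injective (by ext i; simp [h i]))
  have hwt₀ : wt i₀ = γ₀ := by
    by_contra hne
    exact hi₀ (repr_eq_zero_of_mem_maxGenEigenspace B wt b hb γ₀ v₀ hv₀γ i₀ hne)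
  -- the exchanged family is linearly independent
  let b' : Fin n → (Fin n → ℂ) := Function.update (⇑b) i₀ v₀
  have hb'i₀ : b' i₀ = v₀ := Function.update_self _ _ _
  have hb'ne : ∀ i, i ≠ i₀ → b' i = b i := fun i hi => Function.update_of_ne hi _ _
  have hli : LinearIndependent ℂ b' := by
    rw [Fintype.linearIndependent_iff]
    intro g hg
    -- expand `v₀` in the basis `b` and read coordinates
    have hrepr : ∀ j, b.repr (∑ i, g i • b' i) j =
        (if j = i₀ then 0 else g j) + g i₀ * b.repr v₀ j := by
      intro j
      rw [map_sum, Finset.sum_apply']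
      rw [Finset.sum_eq_add_sum_sdiff_singleton_of_mem (Finset.mem_univ i₀)]
      have hrest : ∑ i ∈ Finset.univ \ {i₀}, b.repr (g i • b' i) j = if j = i₀ then 0 else g j := by
        have : ∀ i ∈ Finset.univ \ {i₀}, b.repr (g i • b' i) j = if i = j then g j else 0 := by
          intro i hi
          have hi' : i ≠ i₀ := by simpa using hi
          rw [hb'ne i hi', map_smul, b.repr_self, Finsupp.smul_apply, Finsupp.single_apply, smul_eq_mul]
          split_ifs with h
          · subst h; ring
          · ring
        rw [Finset.sum_congr rfl this]
        split_ifs with hj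
        · subst hj
          exact Finset.sum_eq_zero fun i hi => if_neg (by simpa using hi)
        · rw [Finset.sum_ite_eq' (Finset.univ \ {i₀}) j (fun _ => g j)]
          rw [if_pos (by simpa using hj)]
      rw [hrest, hb'i₀, map_smul, Finsupp.smul_apply, smul_eq_mul]
      ring
    have hzero : ∀ j, (if j = i₀ then 0 else g j) + g i₀ * b.repr v₀ j = 0 := fun j => by
      rw [← hrepr j, hg, map_zero, Finsupp.zero_apply]
    have hg₀ : g i₀ = 0 := by
      have h := hzero i₀
      rw [if_pos rfl, zero_add] at h
      exact (mul_eq_zero.1 h).resolve_right hi₀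
    intro i
    by_cases hi : i = i₀
    · rw [hi]; exact hg₀
    · have h := hzero i
      rwa [if_neg hi, hg₀, zero_mul, add_zero] at h
  haveI : Nonempty (Fin n) := ⟨i₀⟩
  have hcard : Fintype.card (Fin n) = finrank ℂ (Fin n → ℂ) := (Module.finrank_fintype_fun_eq_card ℂ).symm
  let B' : Basis (Fin n) ℂ (Fin n → ℂ) := basisOfLinearIndependentOfCardEqFinrank hli hcard
  have hB' : ⇑B' = b' := coe_basisOfLinearIndependentOfCardEqFinrank hli hcard
  refine ⟨B', wt, i₀, by rw [hB', hb'i₀], hwt₀, fun i => ?_⟩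
  rw [hB']
  by_cases hi : i = i₀
  · subst hi; rw [hb'i₀, hwt₀]; exact hv₀γ
  · rw [hb'ne i hi]; exact hb i

/-! ### The spectral gauge -/

/-- **The spectral gauge of an exact lift.**  For `n × n` complex matrices `Λ` (of rank `n - 1`) and `A_i`, and an
exact lift `(P, Q)` with `P Λ = Λ Q`, `P A_i = c_i · A_i Q`: there are invertible `g, h`, weights `θ, ρ` and an index
`i₀` with `g Λ h = Λ_{i₀}`, `(g A_i h)_{rs} ≠ 0 ⇒ ρ r = c_i θ s`, `ρ = θ` off `i₀`, `ker Λ` inside the generalised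
`θ i₀`-eigenspace of `Q`, and the generalised `ρ i₀`-eigenspace of `P` not inside `range Λ`. -/
theorem exists_spectral_gauge {n : ℕ} (hn : 0 < n) {ι : Type*}
    (Λm : Matrix (Fin n) (Fin n) ℂ) (Am : ι → Matrix (Fin n) (Fin n) ℂ) (c : ι → ℂ)
    (P Q : Matrix (Fin n) (Fin n) ℂ)
    (hΛ : P * Λm = Λm * Q) (hA : ∀ i, P * Am i = c i • (Am i * Q)) (hrank : Λm.rank = n - 1) :
    ∃ (g h : Matrix (Fin n) (Fin n) ℂ) (θ ρ : Fin n → ℂ) (i₀ : Fin n),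
      IsUnit g ∧ IsUnit h ∧
      g * Λm * h = lamMatrix ℂ i₀ ∧
      (∀ i r s, (g * Am i * h) r s ≠ 0 → ρ r = c i * θ s) ∧
      (∀ r, r ≠ i₀ → ρ r = θ r) ∧
      LinearMap.ker (Matrix.toLin' Λm) ≤ maxGenEigenspace (Matrix.toLin' Q) (θ i₀) ∧
      ¬ maxGenEigenspace (Matrix.toLin' P) (ρ i₀) ≤ LinearMap.range (Matrix.toLin' Λm) := by
  classical
  set Λe := Matrix.toLin' Λm with hΛe
  set Pe := Matrix.toLin' P with hPe
  set Qe := Matrix.toLin' Q with hQe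
  have hPΛ : Pe ∘ₗ Λe = (1 : ℂ) • (Λe ∘ₗ Qe) := by
    rw [one_smul, hPe, hΛe, hQe, ← Matrix.toLin'_mul, hΛ, Matrix.toLin'_mul]
  have hPA : ∀ i, Pe ∘ₗ Matrix.toLin' (Am i) = c i • (Matrix.toLin' (Am i) ∘ₗ Qe) := fun i => by
    rw [hPe, hQe, ← Matrix.toLin'_mul, hA i, map_smul, Matrix.toLin'_mul]
  -- the kernel line and its `Q`-weight `γ₀`
  have hK : finrank ℂ (LinearMap.ker Λe) = 1 := LRPencil.finrank_ker_toLin'_eq_one hn hrank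
  obtain ⟨⟨v₀, hv₀K⟩, hv₀ne, hv₀span⟩ := finrank_eq_one_iff'.1 hK
  have hv₀ : v₀ ≠ 0 := fun h => hv₀ne (Subtype.ext h)
  have hΛv₀ : Λe v₀ = 0 := hv₀K
  have hQv₀K : Qe v₀ ∈ LinearMap.ker Λe := by
    rw [LinearMap.mem_ker]
    have := LinearMap.congr_fun hPΛ v₀
    simp only [LinearMap.comp_apply, one_smul] at this
    rw [← this, hΛv₀, map_zero]
  obtain ⟨γ₀, hγ₀⟩ := hv₀span ⟨Qe v₀, hQv₀K⟩
  have hQv₀ : Qe v₀ = γ₀ • v₀ := by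
    have := congrArg Subtype.val hγ₀
    simpa using this.symm
  have hv₀γ : v₀ ∈ maxGenEigenspace Qe γ₀ := by
    apply Module.End.eigenspace_le_maxGenEigenspace
    rw [Module.End.mem_eigenspace_iff, hQv₀]
  have hKer : LinearMap.ker Λe = ℂ ∙ v₀ := by
    ext w
    constructor
    · intro hw
      obtain ⟨a, ha⟩ := hv₀span ⟨w, hw⟩
      have : w = a • v₀ := by
        have := congrArg Subtype.val ha; simpa using this.symm
      rw [this]
      exact Submodule.smul_mem _ _ (Submodule.mem_span_singleton_self v₀)
    · intro hw
      obtain ⟨a, rfl⟩ := Submodule.mem_span_singleton.1 hw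
      rw [LinearMap.mem_ker, map_smul, hΛv₀, smul_zero]
  -- source basis: generalised eigenvectors of `Q`, containing `v₀`
  obtain ⟨b, θ, i₀, hbi₀, hθi₀, hb⟩ := exists_basis_maxGenEigenspace_with Qe v₀ hv₀ γ₀ hv₀γ
  -- target side: a generalised eigenvector of `P` outside `range Λ`
  obtain ⟨β, w, hwβ, hwR⟩ : ∃ (β : ℂ) (w : Fin n → ℂ), w ∈ maxGenEigenspace Pe β ∧
      w ∉ LinearMap.range Λe := by
    by_contra! h
    have htop : (⊤ : Submodule ℂ (Fin n → ℂ)) ≤ LinearMap.range Λe := by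
      rw [← Module.End.iSup_maxGenEigenspace_eq_top Pe]
      exact iSup_le fun β => fun w hw => h β w hw
    have hdim := LinearMap.finrank_range_add_finrank_ker Λe
    rw [hK, eq_top_iff.2 htop, finrank_top] at hdim
    omega
  -- the target family `wv`: `Λ b_i` for `i ≠ i₀`, `w` at `i₀`
  let wv : Fin n → (Fin n → ℂ) := fun i => if i = i₀ then w else Λe (b i)
  have hwv₀ : wv i₀ = w := if_pos rfl
  have hwvne : ∀ i, i ≠ i₀ → wv i = Λe (b i) := fun i hi => if_neg hi
  let ρ : Fin n → ℂ := fun i => if i = i₀ then β else θ i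
  have hρ₀ : ρ i₀ = β := if_pos rfl
  have hρne : ∀ i, i ≠ i₀ → ρ i = θ i := fun i hi => if_neg hi
  have hwvmem : ∀ i, wv i ∈ maxGenEigenspace Pe (ρ i) := by
    intro i
    by_cases hi : i = i₀
    · subst hi; rw [hwv₀, hρ₀]; exact hwβ
    · rw [hwvne i hi, hρne i hi]
      have h1 := map_maxGenEigenspace_le_of_comp_eq_smul Pe Qe Λe 1 hPΛ (θ i)
      rw [one_mul] at h1
      exact h1 (Submodule.mem_map_of_mem (hb i))
  have hliw : LinearIndependent ℂ wv := by
    rw [Fintype.linearIndependent_iff]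
    intro g hg
    -- split off the `i₀` term
    have hsplit : ∑ i, g i • wv i = g i₀ • w + Λe (∑ i ∈ Finset.univ \ {i₀}, g i • b i) := by
      rw [Finset.sum_eq_add_sum_sdiff_singleton_of_mem (Finset.mem_univ i₀), hwv₀, map_sum]
      congr 1
      refine Finset.sum_congr rfl fun i hi => ?_
      have hi' : i ≠ i₀ := by simpa using hi
      rw [hwvne i hi', map_smul]
    have hg₀ : g i₀ = 0 := by
      by_contra hne
      apply hwR
      have hmem : g i₀ • w ∈ LinearMap.range Λe := by
        have : g i₀ • w = ∑ i, g i • wv i - Λe (∑ i ∈ Finset.univ \ {i₀}, g i • b i) := by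
          rw [hsplit]; abel
        rw [this, hg, zero_sub]
        exact Submodule.neg_mem _ (LinearMap.mem_range_self _ _)
      have := Submodule.smul_mem _ (g i₀)⁻¹ hmem
      rwa [smul_smul, inv_mul_cancel₀ hne, one_smul] at this
    have hker : ∑ i ∈ Finset.univ \ {i₀}, g i • b i ∈ LinearMap.ker Λe := by
      rw [LinearMap.mem_ker]
      have := hg
      rw [hsplit, hg₀, zero_smul, zero_add] at this
      exact this
    rw [hKer, Submodule.mem_span_singleton] at hker
    obtain ⟨a, ha⟩ := hker
    -- a linear relation among the `b i`
    have hrel : ∑ i, (if i = i₀ then -a else g i) • b i = 0 := by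
      rw [Finset.sum_eq_add_sum_sdiff_singleton_of_mem (Finset.mem_univ i₀), if_pos rfl, hbi₀]
      have : ∑ i ∈ Finset.univ \ {i₀}, (if i = i₀ then -a else g i) • b i =
          ∑ i ∈ Finset.univ \ {i₀}, g i • b i :=
        Finset.sum_congr rfl fun i hi => by rw [if_neg (by simpa using hi)]
      rw [this, ← ha, neg_smul, neg_add_cancel]
    have hall := Fintype.linearIndependent_iff.mp b.linearIndependent _ hrel
    intro i
    by_cases hi : i = i₀
    · rw [hi]; exact hg₀
    · have := hall i; rwa [if_neg hi] at this
  haveI : Nonempty (Fin n) := ⟨i₀⟩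
  have hcard : Fintype.card (Fin n) = finrank ℂ (Fin n → ℂ) := (Module.finrank_fintype_fun_eq_card ℂ).symm
  let bW : Basis (Fin n) ℂ (Fin n → ℂ) := basisOfLinearIndependentOfCardEqFinrank hliw hcard
  have hbW : ⇑bW = wv := coe_basisOfLinearIndependentOfCardEqFinrank hliw hcard
  have hbWmem : ∀ i, bW i ∈ maxGenEigenspace Pe (ρ i) := fun i => by rw [hbW]; exact hwvmem i
  -- the gauge matrices
  let std : Basis (Fin n) ℂ (Fin n → ℂ) := Pi.basisFun ℂ (Fin n)
  let g : Matrix (Fin n) (Fin n) ℂ := bW.toMatrix std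
  let h : Matrix (Fin n) (Fin n) ℂ := std.toMatrix b
  have hgXh : ∀ X : Matrix (Fin n) (Fin n) ℂ, g * X * h = LinearMap.toMatrix b bW (Matrix.toLin' X) := by
    intro X
    have e1 : LinearMap.toMatrix std std (Matrix.toLin' X) = X := by
      show LinearMap.toMatrix (Pi.basisFun ℂ (Fin n)) (Pi.basisFun ℂ (Fin n)) (Matrix.toLin' X) = X
      rw [LinearMap.toMatrix_eq_toMatrix', LinearMap.toMatrix'_toLin']
    have := basis_toMatrix_mul_linearMap_toMatrix_mul_basis_toMatrix b std bW std (Matrix.toLin' X)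
    rw [e1] at this
    exact this
  have hgU : IsUnit g := by
    have : g * std.toMatrix bW = 1 := Basis.toMatrix_mul_toMatrix_flip _ _
    exact (Matrix.isUnit_iff_isUnit_det _).2
      (Matrix.isUnit_det_of_right_inverse this)
  have hhU : IsUnit h := by
    have : b.toMatrix std * h = 1 := Basis.toMatrix_mul_toMatrix_flip _ _
    exact (Matrix.isUnit_iff_isUnit_det _).2
      (Matrix.isUnit_det_of_left_inverse this)
  refine ⟨g, h, θ, ρ, i₀, hgU, hhU, ?_, ?_, hρne, ?_, ?_⟩
  · -- `g Λ h = Λ_{i₀}`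
    rw [hgXh]
    ext r s
    rw [LinearMap.toMatrix_apply, lamMatrix_apply]
    by_cases hs : s = i₀
    · rw [hs, hbi₀, ← hΛe, hΛv₀, map_zero, Finsupp.zero_apply]
      by_cases hr : r = i₀ <;> simp [hr]
    · have : Λe (b s) = bW s := by rw [hbW, hwvne s hs]
      rw [← hΛe, this, bW.repr_self, Finsupp.single_apply]
      by_cases hrs : r = s
      · subst hrs; rw [if_pos rfl, if_pos rfl, if_neg hs]
      · rw [if_neg (Ne.symm hrs), if_neg hrs]
  · -- graded supports of the coefficient matrices
    intro i r s hrs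
    rw [hgXh, LinearMap.toMatrix_apply] at hrs
    by_contra hne
    apply hrs
    have hmem : Matrix.toLin' (Am i) (b s) ∈ maxGenEigenspace Pe (c i * θ s) :=
      map_maxGenEigenspace_le_of_comp_eq_smul Pe Qe _ (c i) (hPA i) (θ s) (Submodule.mem_map_of_mem (hb s))
    exact repr_eq_zero_of_mem_maxGenEigenspace Pe ρ bW hbWmem _ _ hmem r hne
  · -- the kernel weight
    rw [hKer, hθi₀]
    exact (Submodule.span_singleton_le_iff_mem _ _).2 hv₀γ
  · -- the top weight
    rw [hρ₀]
    exact fun hle => hwR (hle hwβ)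

end SpectralGauge

end Summit.ValiantsHypothesis.ValiantsHypothesis.Theorems.RigidityForcesSymmetryRankRigidMinimalRepr

end
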